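import Summits.Ventures.QEC.Theses.BB72DistanceCertificate
import Summits.Ventures.QEC.Census.BB.BB72.MitmZ
import Summits.Ventures.QEC.Census.BB.BB72Index
import Literature.InformationTheory.QuantumCodes.ParityCheckDuality

/-!
# Route BB72DistanceCertificate, item NoZLogicalBelowSix — closed from the kernel-replayed mitm certificate

The lower bound `∀ v, H^X v = 0 → v ∉ rs H^Z → 6 ≤ |v|` for the typed bivariate-bicycle code `BB.bb72`
(`QC(x³+y+y², y³+x+x²)` on `ℤ₆ × ℤ₆`) from three tree facts:
* `Summit.Ventures.QEC.Census.BB72.mitmZ_ok` (p465258): the meet-in-the-middle replay `wmax = 5 = 3 + 2` of the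
  `Z` side of the certificate literal `BB72.cert` (search-7, = certA 7e943c5a…) passes in the kernel;
* `Summit.Ventures.QEC.Census.mitm_lower_sound` (CertCheckMitm, p464954): hence every word `w : Fin 72 → 𝔽₂` with
  `rowMatrix 72 cert.HX · w = 0`, `w ∉ rs (rowMatrix 72 cert.HZ)` has `5 < |w|`;
* the INDEX IDENTITY `Summit.Ventures.QEC.BB.bb72_HXFlat_eq_ofSupports` / `…HZFlat…` (type-05, p462763) and the
  flat transport lemmas `BB.Code.HXFlat_mulVec_eq_zero_iff` / `mem_rowSpace_HZFlat_iff` / `hammingNorm_comp_equiv`,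
  bridged to the certificate literal by an entrywise `decide` (`rowMatrix 72 cert.HX` row `i` = `ofSupports` row `i`).
-/

namespace Summit.Ventures.QEC.Theorems

open Matrix Literature.InformationTheory.QuantumCodes Summit.Ventures.QEC.Census

/-- The certificate's `H^X` has `36 = 6·6` rows. -/
theorem bb72cert_HX_length : BB72.cert.HX.length = 6 * 6 := by decide

/-- The certificate's `H^Z` has `36 = 6·6` rows. -/
theorem bb72cert_HZ_length : BB72.cert.HZ.length = 6 * 6 := by decide

/-- Row `i` of the certificate's `H^X` word matrix is row `i` of the generator-file support matrix (entrywise,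
kernel `decide`). -/
theorem bb72cert_rowMatrix_HX (i : Fin (6 * 6)) (j : Fin (6 * 6 + 6 * 6)) :
    rowMatrix 72 BB72.cert.HX (Fin.cast bb72cert_HX_length.symm i) j =
      Summit.Ventures.QEC.BB.ofSupports Summit.Ventures.QEC.BB.bb72SupportsX i j := by
  revert i j
  decide +kernel

/-- Row `i` of the certificate's `H^Z` word matrix is row `i` of the generator-file support matrix. -/
theorem bb72cert_rowMatrix_HZ (i : Fin (6 * 6)) (j : Fin (6 * 6 + 6 * 6)) :
    rowMatrix 72 BB72.cert.HZ (Fin.cast bb72cert_HZ_length.symm i) j =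
      Summit.Ventures.QEC.BB.ofSupports Summit.Ventures.QEC.BB.bb72SupportsZ i j := by
  revert i j
  decide +kernel

/-- Kernel transport: `rowMatrix 72 cert.HX · w = 0 ↔ HXFlat · w = 0`. -/
theorem bb72cert_mulVec_HX_eq_zero_iff (w : Fin (6 * 6 + 6 * 6) → ZMod 2) :
    rowMatrix 72 BB72.cert.HX *ᵥ w = 0 ↔ BB.bb72.HXFlat *ᵥ w = 0 := by
  rw [Summit.Ventures.QEC.BB.bb72_HXFlat_eq_ofSupports]
  constructor
  · intro h
    funext i
    have hi := congr_fun h (Fin.cast bb72cert_HX_length.symm i)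
    simp only [mulVec, dotProduct, Pi.zero_apply] at hi ⊢
    rw [← hi]
    exact Finset.sum_congr rfl fun j _ => by rw [bb72cert_rowMatrix_HX]
  · intro h
    funext i
    have hi := congr_fun h (Fin.cast bb72cert_HX_length i)
    simp only [mulVec, dotProduct, Pi.zero_apply] at hi ⊢
    rw [← hi]
    refine Finset.sum_congr rfl fun j _ => ?_
    rw [← bb72cert_rowMatrix_HX]
    simp

/-- Row-space transport: `rs (rowMatrix 72 cert.HZ) = rs HZFlat`. -/
theorem bb72cert_rowSpace_HZ : rowSpace (rowMatrix 72 BB72.cert.HZ) = rowSpace BB.bb72.HZFlat := by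
  rw [Summit.Ventures.QEC.BB.bb72_HZFlat_eq_ofSupports, rowSpace_eq_span_rows, rowSpace_eq_span_rows]
  congr 1
  ext r
  simp only [Set.mem_range]
  constructor
  · rintro ⟨i, rfl⟩
    refine ⟨Fin.cast bb72cert_HZ_length i, funext fun j => ?_⟩
    rw [← bb72cert_rowMatrix_HZ]
    simp
  · rintro ⟨i, rfl⟩
    exact ⟨Fin.cast bb72cert_HZ_length.symm i, funext fun j => bb72cert_rowMatrix_HZ i j⟩

/-- The allow-list of the `Z` side of the certificate decomposes over `H^Z` (it is empty). -/
theorem bb72cert_foundOK_Z : foundOK BB72.cert.HZ BB72.cert.sideZ.found = true := by decide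

/-- **Item NoZLogicalBelowSix** of route BB72DistanceCertificate: every Z-type logical operator of `BB.bb72` has
Hamming weight `≥ 6` — from the kernel-replayed meet-in-the-middle certificate (`BB72.mitmZ_ok`) through
`mitm_lower_sound` and the flat index bridge. -/
theorem noZLogicalBelowSix_proof : Summit.Ventures.QEC.Theses.BB72DistanceCertificate.NoZLogicalBelowSix := by
  unfold Summit.Ventures.QEC.Theses.BB72DistanceCertificate.NoZLogicalBelowSix
  intro v hv hv'
  set w : Fin (6 * 6 + 6 * 6) → ZMod 2 := v ∘ (BB.Code.qubitIndex (ℓ := 6) (m := 6)).symm with hw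
  have hcomp : w ∘ (BB.Code.qubitIndex (ℓ := 6) (m := 6)) = v := by
    funext q; simp [hw]
  have hker : BB.bb72.HXFlat *ᵥ w = 0 :=
    (BB.bb72.HXFlat_mulVec_eq_zero_iff w).2 (by rw [hcomp]; exact hv)
  have hrs : w ∉ rowSpace BB.bb72.HZFlat := fun h =>
    hv' (by have h' := (BB.bb72.mem_rowSpace_HZFlat_iff w).1 h; rwa [hcomp] at h')
  have hker' : rowMatrix 72 BB72.cert.HX *ᵥ w = 0 := (bb72cert_mulVec_HX_eq_zero_iff w).2 hker
  have hrs' : w ∉ rowSpace (rowMatrix 72 BB72.cert.HZ) := by rw [bb72cert_rowSpace_HZ]; exact hrs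
  have hlt := mitm_lower_sound bb72cert_foundOK_Z BB72.mitmZ_ok w hker' hrs'
  have hnorm : hammingNorm w = hammingNorm v := by
    rw [hw]; exact BB.hammingNorm_comp_equiv v (BB.Code.qubitIndex (ℓ := 6) (m := 6)).symm
  change BB72.cert.sideZ.d - 1 < hammingNorm w at hlt
  have h5 : BB72.cert.sideZ.d - 1 = 5 := by decide
  omega

end Summit.Ventures.QEC.Theorems
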